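import Literature.MathematicalPhysics.QuantumLattice.BogoliubovInequality
import Literature.MathematicalPhysics.QuantumLattice.GibbsTwoTimeBound
import HarnessLib

/-!
# The Duhamel two-point function of a general observable versus its equal-time correlations

For a Hermitian `H : Matrix n n ℂ`, inverse temperature `β` and ANY matrix `A` (not necessarily
Hermitian) the Duhamel (Bogoliubov, Kubo–Mori) two-point function
`(A, Aᴴ) = Z⁻¹ ∫₀¹ tr(A e^{-sβH} Aᴴ e^{-(1-s)βH}) ds` (`Matrix.duhamel β H A Aᴴ` of
`DuhamelTwoPoint.lean`) is the pair sum `Z⁻¹ Σᵢⱼ |A'ᵢⱼ|² K_β(Eᵢ,Eⱼ)` over an eigenbasis of `H`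
(`A' = U⋆AU`, `K_β` the logarithmic-mean kernel `Matrix.duhamelKernel`), hence REAL, NON-NEGATIVE,
and — "logarithmic mean ≤ arithmetic mean" (`duhamelKernel_le_half_add_exp`) — bounded by the
symmetrised equal-time correlation:

  `0 ≤ Re (A, Aᴴ) ≤ ½ (Re ⟨A Aᴴ⟩ + Re ⟨Aᴴ A⟩)`                                   (DLS `b ≤ g`)

([DLS1978] Thm. 3.1 with (35)–(36): `b(A) ≤ g(A) = ½⟨AᴴA + AAᴴ⟩`, stated there for general `A`;
[LSSY2005] Ch. 11 after (11.9)).  `DuhamelTwoPoint.lean` / `BogoliubovInequality.lean` carry the pair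
sums only for HERMITIAN `A`; this file supplies the general case, in the unnormalised form
(traces, no `Z⁻¹`; `re_integral_trace_duhamel_conjTranspose_le`) and the normalised form
(`re_duhamel_conjTranspose_le`), together with the **sector form**: for an idempotent Hermitian
`P` commuting with the Gibbs weights, `∫₀¹ Re tr(P Bᴴ e^{-sβH} B e^{-(1-s)βH}) ds` is the
unnormalised Duhamel function of `A := P Bᴴ` (`trace_proj_duhamel_integrand_eq`) and is therefore
`≤ ½ (Re tr(e^{-βH} P BᴴB) + Re tr(e^{-βH} B P Bᴴ))` (`re_integral_trace_proj_duhamel_le`) — the step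
from a time-averaged (susceptibility-type) pair correlation in a symmetry sector to equal-time pair
correlations, for a non-Hermitian order parameter `B` (e.g. a pair field, which changes the sector).
No definition is introduced.
-/

noncomputable section

open scoped Matrix.Norms.L2Operator ComplexOrder
open Finset MeasureTheory intervalIntegral Matrix

namespace Literature.MathematicalPhysics.QuantumLattice

variable {n : Type*} [Fintype n] [DecidableEq n] {H : Matrix n n ℂ}

/-- **Spectral form of the Duhamel integrand for a general observable**:
`tr(A e^{-sβH} Aᴴ e^{-(1-s)βH}) = Σᵢⱼ |A'ᵢⱼ|² e^{-β(sEⱼ + (1-s)Eᵢ)}`, `A' = U⋆AU`.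
[cite: DLS1978, eq. (35)] -/
theorem trace_duhamel_integrand_conjTranspose (hH : H.IsHermitian) (A : Matrix n n ℂ) (β s : ℝ) :
    (A * gibbsWeight (s * β) H * Aᴴ * gibbsWeight ((1 - s) * β) H).trace =
      ∑ i, ∑ j, ((‖(star (hH.eigenvectorUnitary : Matrix n n ℂ) * A *
          (hH.eigenvectorUnitary : Matrix n n ℂ)) i j‖ ^ 2 *
            Real.exp (-(β * (s * hH.eigenvalues j + (1 - s) * hH.eigenvalues i))) : ℝ) : ℂ) := by
  have hcyc : (A * gibbsWeight (s * β) H * Aᴴ * gibbsWeight ((1 - s) * β) H).trace =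
      (gibbsWeight ((1 - s) * β) H * A * gibbsWeight (s * β) H * Aᴴ).trace := by
    rw [Matrix.trace_mul_comm]
    simp only [Matrix.mul_assoc]
  have hadj : star (hH.eigenvectorUnitary : Matrix n n ℂ) * Aᴴ * (hH.eigenvectorUnitary : Matrix n n ℂ) =
      (star (hH.eigenvectorUnitary : Matrix n n ℂ) * A * (hH.eigenvectorUnitary : Matrix n n ℂ))ᴴ := by
    rw [Matrix.conjTranspose_mul, Matrix.conjTranspose_mul, Matrix.star_eq_conjTranspose,
      Matrix.conjTranspose_conjTranspose, Matrix.mul_assoc]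
  rw [hcyc, trace_gibbsWeight_mul_mul_gibbsWeight_mul_eq_sum hH, hadj]
  refine sum_congr rfl fun i _ => sum_congr rfl fun j _ => ?_
  set a : ℂ := (star (hH.eigenvectorUnitary : Matrix n n ℂ) * A *
    (hH.eigenvectorUnitary : Matrix n n ℂ)) i j with ha
  rw [Matrix.conjTranspose_apply]
  have h1 : (Real.exp (-((1 - s) * β) * hH.eigenvalues i) : ℂ) * a *
      (Real.exp (-(s * β) * hH.eigenvalues j) : ℂ) * star a =
      (a * star a) * ((Real.exp (-(s * β) * hH.eigenvalues j) : ℂ) *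
        (Real.exp (-((1 - s) * β) * hH.eigenvalues i) : ℂ)) := by ring
  rw [h1, mul_star_eq_normSq_cast, ← Complex.ofReal_mul, ← Complex.ofReal_mul, ← Real.exp_add]
  congr 3
  ring

/-- **Pair-sum form of the unnormalised Duhamel function of a general observable**:
`Re ∫₀¹ tr(A e^{-sβH} Aᴴ e^{-(1-s)βH}) ds = Σᵢⱼ |A'ᵢⱼ|² K_β(Eᵢ,Eⱼ)`. [cite: DLS1978, eq. (35)] -/
theorem re_integral_trace_duhamel_conjTranspose_eq (hH : H.IsHermitian) (A : Matrix n n ℂ) (β : ℝ) :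
    (∫ s in (0 : ℝ)..1, (A * gibbsWeight (s * β) H * Aᴴ * gibbsWeight ((1 - s) * β) H).trace).re =
      ∑ i, ∑ j, ‖(star (hH.eigenvectorUnitary : Matrix n n ℂ) * A *
          (hH.eigenvectorUnitary : Matrix n n ℂ)) i j‖ ^ 2 *
            duhamelKernel β (hH.eigenvalues i) (hH.eigenvalues j) := by
  simp_rw [trace_duhamel_integrand_conjTranspose hH A β, ← Complex.ofReal_sum]
  rw [intervalIntegral.integral_ofReal, Complex.ofReal_re, integral_sum_sum_mul_exp]

/-- The unnormalised Duhamel function of a general observable is non-negative.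
[cite: DLS1978, Thm. 3.1] -/
theorem re_integral_trace_duhamel_conjTranspose_nonneg (hH : H.IsHermitian) (A : Matrix n n ℂ)
    (β : ℝ) :
    0 ≤ (∫ s in (0 : ℝ)..1,
      (A * gibbsWeight (s * β) H * Aᴴ * gibbsWeight ((1 - s) * β) H).trace).re := by
  rw [re_integral_trace_duhamel_conjTranspose_eq hH]
  exact sum_nonneg fun i _ => sum_nonneg fun j _ =>
    mul_nonneg (sq_nonneg _) (duhamelKernel_pos β _ _).le

/-- **`b ≤ g`, unnormalised**: `Re ∫₀¹ tr(A e^{-sβH} Aᴴ e^{-(1-s)βH}) ds ≤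
½ (Re tr(e^{-βH} A Aᴴ) + Re tr(e^{-βH} Aᴴ A))` for ANY `A` ("logarithmic mean ≤ arithmetic mean",
termwise on the pair sums). [cite: DLS1978, Thm. 3.1] -/
theorem re_integral_trace_duhamel_conjTranspose_le (hH : H.IsHermitian) (A : Matrix n n ℂ) (β : ℝ) :
    (∫ s in (0 : ℝ)..1,
      (A * gibbsWeight (s * β) H * Aᴴ * gibbsWeight ((1 - s) * β) H).trace).re ≤
      (((gibbsWeight β H * (A * Aᴴ)).trace).re + ((gibbsWeight β H * (Aᴴ * A)).trace).re) / 2 := by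
  rw [re_integral_trace_duhamel_conjTranspose_eq hH, re_trace_gibbsWeight_mul_mul_conjTranspose hH,
    re_trace_gibbsWeight_mul_conjTranspose_mul hH, ← sum_add_distrib, Finset.sum_div]
  refine sum_le_sum fun i _ => ?_
  rw [← sum_add_distrib, Finset.sum_div]
  refine sum_le_sum fun j _ => ?_
  have hK := duhamelKernel_le_half_add_exp β (hH.eigenvalues i) (hH.eigenvalues j)
  have hsq := sq_nonneg ‖(star (hH.eigenvectorUnitary : Matrix n n ℂ) * A *
    (hH.eigenvectorUnitary : Matrix n n ℂ)) i j‖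
  rw [neg_mul, neg_mul]
  nlinarith

/-- **Pair-sum form of the Duhamel function of a general observable**:
`Re (A, Aᴴ) = Z⁻¹ Σᵢⱼ |A'ᵢⱼ|² K_β(Eᵢ,Eⱼ)`. [cite: DLS1978, eq. (35)] -/
theorem re_duhamel_conjTranspose_eq (hH : H.IsHermitian) (A : Matrix n n ℂ) (β : ℝ) :
    (duhamel β H A Aᴴ).re = (∑ i, Real.exp (-(β * hH.eigenvalues i)))⁻¹ *
      ∑ i, ∑ j, ‖(star (hH.eigenvectorUnitary : Matrix n n ℂ) * A *
          (hH.eigenvectorUnitary : Matrix n n ℂ)) i j‖ ^ 2 *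
            duhamelKernel β (hH.eigenvalues i) (hH.eigenvalues j) := by
  rw [hH.re_duhamel, re_integral_trace_duhamel_conjTranspose_eq hH]

/-- `Re (A, Aᴴ) ≥ 0` for any `A`. [cite: DLS1978, Thm. 3.1] -/
theorem re_duhamel_conjTranspose_nonneg (hH : H.IsHermitian) (A : Matrix n n ℂ) (β : ℝ) :
    0 ≤ (duhamel β H A Aᴴ).re := by
  rw [hH.re_duhamel]
  exact mul_nonneg (inv_nonneg.2 (sum_nonneg fun i _ => (Real.exp_pos _).le))
    (re_integral_trace_duhamel_conjTranspose_nonneg hH A β)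

/-- **`b ≤ g` (DLS) for a general observable**: `Re (A, Aᴴ) ≤ ½ (Re ⟨A Aᴴ⟩ + Re ⟨Aᴴ A⟩)` in the
Gibbs state `⟨·⟩ = tr(e^{-βH} ·)/Z`. [cite: DLS1978, Thm. 3.1] -/
theorem re_duhamel_conjTranspose_le (hH : H.IsHermitian) (A : Matrix n n ℂ) (β : ℝ) :
    (duhamel β H A Aᴴ).re ≤ ((gibbsState β H (A * Aᴴ)).re + (gibbsState β H (Aᴴ * A)).re) / 2 := by
  rw [hH.re_duhamel, hH.re_gibbsState, hH.re_gibbsState, ← mul_add, mul_div_assoc]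
  exact mul_le_mul_of_nonneg_left (re_integral_trace_duhamel_conjTranspose_le hH A β)
    (inv_nonneg.2 (sum_nonneg fun i _ => (Real.exp_pos _).le))

/-! ### Sector form: an idempotent Hermitian `P` commuting with the Gibbs weights -/

/-- **Sector Duhamel integrand = plain Duhamel integrand of `P Bᴴ`.** For an idempotent Hermitian
`P` commuting with the Gibbs weights, `tr(P Bᴴ e^{-sβH} B e^{-(1-s)βH}) =
tr(A e^{-sβH} Aᴴ e^{-(1-s)βH})` with `A = P Bᴴ` (cyclicity). [folklore] -/
theorem trace_proj_duhamel_integrand_eq {P : Matrix n n ℂ} (hPP : P * P = P) (hPh : Pᴴ = P)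
    (hPg : ∀ t : ℝ, P * gibbsWeight t H = gibbsWeight t H * P) (B : Matrix n n ℂ) (β s : ℝ) :
    (P * Bᴴ * gibbsWeight (s * β) H * B * gibbsWeight ((1 - s) * β) H).trace =
      ((P * Bᴴ) * gibbsWeight (s * β) H * (P * Bᴴ)ᴴ * gibbsWeight ((1 - s) * β) H).trace := by
  rw [Matrix.conjTranspose_mul, Matrix.conjTranspose_conjTranspose, hPh]
  symm
  calc (P * Bᴴ * gibbsWeight (s * β) H * (B * P) * gibbsWeight ((1 - s) * β) H).trace
      = (P * Bᴴ * gibbsWeight (s * β) H * B * (P * gibbsWeight ((1 - s) * β) H)).trace := by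
        simp only [Matrix.mul_assoc]
    _ = ((P * Bᴴ * gibbsWeight (s * β) H * B * gibbsWeight ((1 - s) * β) H) * P).trace := by
        rw [hPg]; simp only [Matrix.mul_assoc]
    _ = (P * (P * Bᴴ * gibbsWeight (s * β) H * B * gibbsWeight ((1 - s) * β) H)).trace :=
        Matrix.trace_mul_comm _ P
    _ = ((P * P) * Bᴴ * gibbsWeight (s * β) H * B * gibbsWeight ((1 - s) * β) H).trace := by
        simp only [Matrix.mul_assoc]
    _ = (P * Bᴴ * gibbsWeight (s * β) H * B * gibbsWeight ((1 - s) * β) H).trace := by rw [hPP]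

/-- The first equal-time trace of `A = P Bᴴ`: `tr(e^{-βH} A Aᴴ) = tr(e^{-βH} P BᴴB)` (the sector
expectation of `BᴴB`). [folklore] -/
theorem trace_gibbsWeight_mul_proj_conjTranspose_mul {P : Matrix n n ℂ} (hPP : P * P = P)
    (hPh : Pᴴ = P) (hPg : ∀ t : ℝ, P * gibbsWeight t H = gibbsWeight t H * P) (B : Matrix n n ℂ)
    (β : ℝ) :
    (gibbsWeight β H * ((P * Bᴴ) * (P * Bᴴ)ᴴ)).trace = (gibbsWeight β H * (P * (Bᴴ * B))).trace := by
  rw [Matrix.conjTranspose_mul, Matrix.conjTranspose_conjTranspose, hPh]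
  calc (gibbsWeight β H * (P * Bᴴ * (B * P))).trace
      = ((gibbsWeight β H * P * Bᴴ * B) * P).trace := by simp only [Matrix.mul_assoc]
    _ = (P * (gibbsWeight β H * P * Bᴴ * B)).trace := Matrix.trace_mul_comm _ P
    _ = ((P * gibbsWeight β H) * P * Bᴴ * B).trace := by simp only [Matrix.mul_assoc]
    _ = ((gibbsWeight β H * P) * P * Bᴴ * B).trace := by rw [hPg]
    _ = (gibbsWeight β H * (P * P) * Bᴴ * B).trace := by simp only [Matrix.mul_assoc]
    _ = (gibbsWeight β H * (P * (Bᴴ * B))).trace := by rw [hPP]; simp only [Matrix.mul_assoc]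

omit [DecidableEq n] in
/-- The second equal-time trace of `A = P Bᴴ`: `Aᴴ A = B P Bᴴ` (lives in the image sector of `B`).
[folklore] -/
theorem proj_conjTranspose_mul_conjTranspose_mul {P : Matrix n n ℂ} (hPP : P * P = P)
    (hPh : Pᴴ = P) (B : Matrix n n ℂ) :
    (P * Bᴴ)ᴴ * (P * Bᴴ) = B * P * Bᴴ := by
  rw [Matrix.conjTranspose_mul, Matrix.conjTranspose_conjTranspose, hPh,
    show B * P * (P * Bᴴ) = B * (P * P) * Bᴴ by simp only [Matrix.mul_assoc], hPP]

/-- **Sector `b ≤ g` for a general (sector-changing) observable.** For a Hermitian `H`, an idempotent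
Hermitian `P` commuting with the Gibbs weights (e.g. the projection onto a symmetry sector), any `B`
and `β`:
`0 ≤ ∫₀¹ Re tr(P Bᴴ e^{-sβH} B e^{-(1-s)βH}) ds ≤ ½ (Re tr(e^{-βH} P BᴴB) + Re tr(e^{-βH} B P Bᴴ))`
— the time-averaged pair correlation in the sector is dominated by the two equal-time orderings
(the second one is the expectation of `B P Bᴴ`, supported in the image sector of `B`).
[cite: DLS1978, Thm. 3.1] -/
theorem re_integral_trace_proj_duhamel_le (hH : H.IsHermitian) {P : Matrix n n ℂ} (hPP : P * P = P)
    (hPh : Pᴴ = P) (hPg : ∀ t : ℝ, P * gibbsWeight t H = gibbsWeight t H * P) (B : Matrix n n ℂ)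
    (β : ℝ) :
    0 ≤ (∫ s in (0 : ℝ)..1,
        (P * Bᴴ * gibbsWeight (s * β) H * B * gibbsWeight ((1 - s) * β) H).trace).re ∧
    (∫ s in (0 : ℝ)..1,
        (P * Bᴴ * gibbsWeight (s * β) H * B * gibbsWeight ((1 - s) * β) H).trace).re ≤
      (((gibbsWeight β H * (P * (Bᴴ * B))).trace).re +
        ((gibbsWeight β H * (B * P * Bᴴ)).trace).re) / 2 := by
  simp_rw [trace_proj_duhamel_integrand_eq hPP hPh hPg B β]
  refine ⟨re_integral_trace_duhamel_conjTranspose_nonneg hH _ β, ?_⟩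
  have h := re_integral_trace_duhamel_conjTranspose_le hH (P * Bᴴ) β
  rwa [trace_gibbsWeight_mul_proj_conjTranspose_mul hPP hPh hPg,
    proj_conjTranspose_mul_conjTranspose_mul hPP hPh] at h

end Literature.MathematicalPhysics.QuantumLattice

end
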